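import Literature.MathematicalPhysics.QuantumFieldTheory.Balaban1983to89.B2Ineq311CondDelta
import Literature.MathematicalPhysics.QuantumFieldTheory.Balaban1983to89.B2Eq324NestedRegions

/-!
# `Balaban1983to89.B2Eq39ConcreteForms` — [Balaban1982Higgs2] (3.9) p. 585 and (3.11) p. 585: the quadratic forms
`⟨A_k, G′_kA_k⟩`, `⟨φ_k, G″_kφ_k⟩` *"connected with the first four terms in the exponential under the integral (3.9)"* AS
CONCRETE OBJECTS on the (Higgs)₂,₃ carrier — the multi-scale averaging squares
`Σ_{l=k+1}^{K} a_{l−k}(L^{l−k})^{d−2}Σ_{x_l∈Λ₅^{(l−1)′}∩Λ₅^{(l)c}}|(Q_{l−k}(Ã)·)(x_l)|²` PLUS the block of the CONDITIONAL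
renormalization-group operator `⟨Λ₅⁽ᵏ⁾·, Δ^{(k)}_{Λ₅^{(k−1)}}(Ω, Ã)Λ₅⁽ᵏ⁾·⟩` of (2.46)/(2.27) (the typer's `B2Eq227CondDelta.condDelta227`)
— and **(3.11) `G′_k ≧ γ₁μ₀²(Lᵏε)²I↾_{Λ₅⁽ᵏ⁾}`, `G″_k ≧ γ₁m²(Lᵏε)²I↾_{Λ₅⁽ᵏ⁾}` PROVED FOR THEM** by the printed mechanism *"it
suffices to use the mass terms in the fundamental operators"*: the new step is the mass-term lower bound for the
CONDITIONAL operator `Δ^{(k+1)}_Λ(Ω, Ã)` of (2.27) (`siteInner_condDelta227_ge_of_lower`; r02 g7 `B2Ineq311DeltaKConcrete` did the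
unconditioned `Δ^{(k)}(Ω, Ã)` of (I.2.21); r02 g9's PARALLEL `B2Ineq311CondDelta` p312044 — same commit — proves the same conditional
bound for `Λ′`-supported fields with a level-recursive constant: imported, its one-step Jensen lemma reused), with ONE
`γ₁ = a_∞/(a_∞ + 2m²)` for all steps, volumes, regions and fields

statement-level skeleton of published theorems with citation tags; proofs where landed; nothing here is a claim about the Yang–Mills mass gap

CITATION HEADER.  T. Bałaban, *(Higgs)₂,₃ quantum fields in a finite volume. II. An upper bound*, Commun. Math. Phys. **86**
(1982) 555–594 [Balaban1982Higgs2] (PDF held `paper:balaban1982-cmp86-higgs23-ii`, journal page = PDF page + 554; pp. 562, 567,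
584–586 [PDF 8, 13, 30–32] READ AS IMAGES on the ×2 renders
`run/shared/lean/pub/pub-balaban/b2b-balaban-ref1/pages/1982-cmp86-higgs23-II/1982-cmp86-higgs23-II-p013/p030/p031/p032-x2.png` and on
the text layer `p0031.txt`); part I [Balaban1982Higgs1] (2.15) p. 609, (2.21) p. 610, (2.30)–(2.32) p. 611.  Cell `lit-balaban`
(HOME `run/shared/lean/pub/lit-balaban/`), Phase-2 proof seat **p23** gen 11 (unit `lit-balaban-p23-g11`; TAKING line HOME/STATUS.md
2026-08-22T00:23:36Z).  SKELETON rows **B2.Eq3.11** «(3.11)–(3.12)» (owner r02; head `typed` *"ONLY because G′_k, G″_k of (3.9)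
as whole concrete objects are not constructed in the tree"*, ROWS-B2 v2.48) and **B2.Eq3.1-3.10** member (3.9) (born v2.54);
second reader r14, referee ref-4.  USED BY NAME, NOTHING RESTATED: the typer's `B2Eq227CondDelta.{condDelta227, stepCoef,
stepCoef_pos, siteInner_condDelta227, precOpA_eq, condDelta227_zero_field}` ((2.27), gen 5), `HiggsCondCov232.{condCov232,
condCov232_cutTo, restrictOp_precOpA_condCov232_apply, restrictInv_apply, cutTo_cutTo, siteInner_cutTo, siteInner_restrictOp}`
((I.2.32)), p35's `B1Eq230FluctCov.{deltaKA, precOpA, blockProjA}` / `B1Eq230FluctCovPos.{siteInner_blockProjA_eq,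
siteInner_deltaKA_zero_ge}` ((I.2.21), (I.2.30)), `B1Eq27StepAdjoint.{avgQLin, avgQAdjLin, siteInner_avgQLin, avgQLin_avgQAdjLin,
avgQAdjLin_apply}` ((I.2.7)), r02 g7 `B2Ineq311DeltaKConcrete.siteInner_deltaKA_succ_ge_uniform` ((3.11) for `Δ^{(k)}(Ω, Ã)`), r02 g9
`B2Ineq311CondDelta.siteInner_avgQLin_self_le` (one-step covariant Jensen from `QQ^* = 1`; p312044), p15's `B2Eq324NestedRegions.{Tower,
prime, mem_prime, Tower.nested, Tower.isUnion}` ((3.22)–(3.24)), r14 g4's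
`a_∞` shape, the typer's `HiggsLattice.{siteInner, blockSet, mem_blockSet}`, `B2Eq255Concrete.cutTo`, `HiggsCovarianceCont.{sNorm,
abs_siteInner_le, sNorm_sq}`, b2b's `B1.aSeq`/`B1.aSeq_pos`.

WHAT IS PRINTED.  p. 585 [PDF 31], (3.9) (read as image; the first four terms of the exponential):
*"∫dA_k↾_{Λ₅⁽ᵏ⁾}∫dφ_k↾_{Λ₅⁽ᵏ⁾} exp[−½Σ_{l=k+1}^{K} a_{l−k}(L^{l−k})^{d−2}Σ_{x_l∈Λ₅^{(l−1)′}∩Λ₅^{(l)c}}|A_l(x_l) − (Q_{l−k}A_k)(x_l)|²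
− ½Σ_{l=k+1}^{K} a_{l−k}(L^{l−k})^{d−2}Σ_{x_l∈Λ₅^{(l−1)′}∩Λ₅^{(l)c}}|φ_l(x_l) − (Q_{l−k}(Ã^{(k+1)})φ_k)(x_l)|²
− ½⟨Λ₅⁽ᵏ⁾A_k, Δ^{(k)}_{Λ₅^{(k−1)}}Λ₅⁽ᵏ⁾A_k⟩ − ½⟨Λ₅⁽ᵏ⁾φ_k, Δ^{(k)}_{Λ₅^{(k−1)}}(Bᵏ(Λ₂^{(k−1)′}), Ã^{(k)})Λ₅⁽ᵏ⁾φ_k⟩ − … ]"*; then,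
verbatim: *"We need the estimates of the quadratic forms in (3.9). Let us denote the quadratic forms in A_k, φ_k, connected with
the first four terms in the exponential under the integral (3.9), by ⟨A_k, G′_kA_k⟩, ⟨φ_k, G″_kφ_k⟩ correspondingly. We will give
the estimates from below for these forms. It is sufficient to get very weak estimates because we have the strong estimates (3.8),
(3.10). To get them it suffices to use the mass terms in the fundamental operators −Δ^η + μ₀²(Lᵏε)² and
−Δ^{η,N}_{Ã^{(k)},Bᵏ(Λ₂^{(k−1)′})} + m²(Lᵏε)². In the next section of this chapter we will formulate a much stronger estimate, which
as a corollary gives  G′_k ≧ γ₁μ₀²(Lᵏε)²I↾_{Λ₅⁽ᵏ⁾},  G″_k ≧ γ₁m²(Lᵏε)²I↾_{Λ₅⁽ᵏ⁾}. (3.11)"*.  p. 567 [PDF 13], (2.46): the operators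
`Δ^{(k),Lᵏε}_{Λ₅^{(k−1)}}` and `Δ^{(k),Lᵏε}_{Λ₅^{(k−1)}}(B^{k−1}(Λ₂^{(k−1)}), A^{(k),ε})` produced by *"calculation of a conditional integral
in (2.45) with the conditioning on Λ₅^{(k−1)c}"*; p. 562 [PDF 8], (2.27), verbatim: *"the general formula ⟨ψ, Δ^{(k+1),L}_Λ(Ω, A)ψ⟩
= aL^{d−2}Σ_{y∈Λ′}|ψ(y)|² − a²L^{−4}⟨ψ, Q(A)C^{(k)}_Λ(Ω, A)Q^*(A)ψ⟩, Λ ⊂ Ω^{(k)}, (2.27) and the similar formula holds for the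
vector field"*; part I p. 611 (2.32): *"C^{(k)}_Λ(Ω, A) = ((aL^{−2}P(A) + Δ^{(k)}(Ω, A))↾_Λ)^{−1}"*, p. 610 (2.17)/(2.21): `Δ^{(0)} = −Δ^{ε,N}_{A,Ω}
+ m²`, the solved form of `Δ^{(k)}`.

THE MASS-TERM ARGUMENT FOR THE CONDITIONAL OPERATOR (§1; this file's new mathematics, five lines).  Let `β = a(L^{k+1}ε)^{−2}`,
`M = βP(A) + Δ^{(k)}(Ω,A)` on the fields of `T^{(k)}`, `Λ = B(Λ′)`, `C_Λ = (M↾_Λ)^{−1}`, and suppose `Δ^{(k)}(Ω,A) ≥ μ` (the MASS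
TERM of the fundamental operator: `μ = m²` at `k = 0` by (I.2.17); `μ = [a_k/(a_k + m²(Lᵏε)²)]m²` at `k ≥ 1`, r02's theorem).  For
`ψ` on `T^{(k+1)}` put `ψ′ = Λ′ψ`, `w = Q^*(A)ψ′` (supported in `Λ`), `φ = C_Λw` (supported in `Λ`, `ΛMφ = w`).  Then
`X := ⟨w, φ⟩ = ⟨φ, Mφ⟩ = β|Q(A)φ|² + ⟨φ, Δ^{(k)}φ⟩ ≥ (β + μ)|Q(A)φ|²` (`|Q(A)φ| ≤ |φ|`: `QQ^* = 1`, `Q^*` the adjoint) and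
`X = ⟨ψ′, Q(A)φ⟩ ≤ |ψ′||Q(A)φ|`, whence `(β + μ)X ≤ |ψ′|²` and, by (2.27), `⟨ψ, Δ^{(k+1)}_Λψ⟩ = β|ψ′|² − β²X ≥ [βμ/(β + μ)]·|Λ′ψ|²`.

UNITS.  Everything is on the physical lattices `T^{(k)}_{Lᵏε}` with the scalar products (I.1.5) (the typer's convention); the
printed (3.9)/(3.11) are written after *"rescaling from Lᵏε-lattice to 1-lattice"* (p. 584): the printed coefficient
`a_{l−k}(L^{l−k})^{d−2}Σ_{x_l}|·|²` is `a_{l−k}(L^lε)^{−2}·‖·‖²_{T^{(l)}}` in physical units (`‖f‖²_{T^{(l)}} = (L^lε)^dΣ|f|²`), and the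
printed `γ₁m²(Lᵏε)²I` is `γ₁m²·I` (the mass term of the physical fundamental operator is `m²`, not `m²(Lᵏε)²`).

WHAT THIS MODULE PROVES (kernel-checked, 0 `sorry`, standard axioms; §2–§3 contain DEFINITIONS WITH BODIES: the iterated
one-step averaging `avgQIter` and the (3.9) geometry/forms `Geom39`, `sqForm39`, `form39`; no `Prop`-valued fact).
 §1 `hmean_mono` (`βμ/(β+μ)` increases in both arguments), `cutTo_blockSet_avgQAdjLin` (`B(Λ′)Q^*(A)ψ = Q^*(A)(Λ′ψ)`; the
    one-step covariant Jensen `|Q(A)φ| ≤ |φ|` is r02 g9's `B2Ineq311CondDelta.siteInner_avgQLin_self_le`, reused — v1.1),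
    **`siteInner_condDelta227_ge_of_lower`** (the argument above: `Δ^{(k)}(Ω,A) ≥ μ ≥ 0` ⇒ `[βμ/(β+μ)]·‖Λ′ψ‖² ≤
    ⟨ψ, Δ^{(k+1)}_Λ(Ω,A)ψ⟩`, EVERY `C`, `Ω`, `A`, `Λ′`, `ψ`; m² > 0, a > 0, L > 1, k < K), `siteInner_condDelta227_zero_ge` (`k = 0`,
    `μ = m²`), `siteInner_condDelta227_succ_ge` (`k ≥ 1`, r02's `μ`), `gamma1_cond_le` + **`siteInner_condDelta227_ge_uniform`**
    (ONE `γ₁ = a_∞/(a_∞ + 2m²)`, `a_∞ = a(1 − L⁻²)`: `γ₁·m²·‖Λ′ψ‖² ≤ ⟨ψ, Δ^{(k+1)}_Λ(Ω,A)ψ⟩` for every `k < K` with `L^{k+1}ε ≤ 1`),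
    `siteInner_condDelta227_vec_ge_uniform` (the VECTOR species: trivial coupling, zero field, whole torus, mass `μ₀²`).
 §2 `avgQIter C A k n = Q(A)∘⋯∘Q(A) : T^{(k)} → T^{(k+n)}` (the composite `Q_n` of (I.2.12)/(2.14) started at level `k`),
    `avgQIter_zero/_succ/_one`.
 §3 `Geom39` (the geometry of ONE integral (3.9): level `k = j+1`, the conditioning indices `Λc ↤ Λ₅^{(k−1)′}`, the region
    `Λ5 ↤ Λ₅⁽ᵏ⁾ ⊂ Λ₅^{(k−1)′}`, the higher regions `reg n ↤ Λ₅^{(k+n−1)′}∩Λ₅^{(k+n)c}`, `n = 1,…,M = K − k`), `sqForm39` (the averaging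
    squares), **`form39`** (= `⟨B, G_kB⟩`, both species by the choice of `(C, Ω, A_Δ, A_Q, mass)`), `form39_eq`, `sqForm39_nonneg`;
    (v1.1) **`Geom39.ofTower`**: THE GEOMETRY OF BAŁABAN'S RUNS — from the §3 tower of large-field regions `B2Eq324NestedRegions.Tower`
    (p15): `Λc = Λ₅^{(k−1)′}` (`prime`), `Λ5 = Λ₅⁽ᵏ⁾`, `reg (n+1) = Λ₅^{(k+n)′} ∖ Λ₅^{(k+n+1)} = T.regions.block (k+n)` DEFINITIONALLY
    (`towerPieceFrom`, `ofTower_reg_succ`), nesting from `Tower.nested` ((3.22)), `blockSet_prime_lam`/`blockSet_ofTower_Λc` (`B(Λ₅^{(k−1)′}) = Λ₅^{(k−1)}`).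
 §4 **`ineq311_form39`**: `γ₁·m²·‖Λ₅⁽ᵏ⁾B‖² ≤ ⟨B, G″_kB⟩` with `γ₁ = a_∞/(a_∞ + 2m²)` for EVERY geometry, `C`, `Ω`, `A_Δ`, `A_Q`, `B`
    (m² > 0, a > 0, L > 1, `Lᵏε ≤ 1`); **`ineq311_form39_vec`**: `γ₁·μ₀²·‖Λ₅⁽ᵏ⁾B‖² ≤ ⟨B, G′_kB⟩` (vector species, the SAME geometry
    with trivial transports); (v1.1) **`ineq311_form39_tower`** / `_tower_vec` (the same for the geometry of a §3 tower at every level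
    `1 ≤ k ≤ K`); `exists_geom39` (non-vacuity of the geometry for every `K ≥ 1`).
HONEST SCOPE.  (i) `G′_k`, `G″_k` are represented by their QUADRATIC FORMS `B ↦ ⟨B, G_kB⟩` (real-valued functions of a field on
`T^{(k)}`), which is all (3.11) and the Gaussian bookkeeping (3.17) use; (3.11)'s `I↾_{Λ₅⁽ᵏ⁾}` = the form inequality with `‖Λ₅⁽ᵏ⁾B‖²`.
(ii) The theorem holds for ANY geometry `Geom39` (any index sets); Bałaban's is `Geom39.ofTower` (v1.1; the relative level index
`n` of `reg` matches the tower's `(j + 1 + n) + 1`-indexed `Regions.block` definitionally by pattern matching on `n`).  The external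
fields `A_Δ`, `A_Q` (print: `Ã^{(k)}`, `Ã^{(k+1)}` of (3.4)) and the region `Ω` (print: `Bᵏ(Λ₂^{(k−1)′})`) are parameters — the bound
is uniform in them.  (iii) `γ₁`
here depends on `a`, `L` (through `a_∞ = a(1 − L⁻²) ≥ ¾a`) and on `m²` (resp. `μ₀²`); print leaves `γ₁` unspecified (*"very weak
estimates"*), with *"m² ≦ O(1)"* on p. 589.  (iv) This is the printed *"it suffices to use the mass terms"* road; the *"much stronger
estimate … as a corollary"* road (Prop. 3.1) is rows B2.Prop3.1/B2.Eq3.29.  (v) Level `k = j + 1 ≥ 1` (the integrals (3.9) occur for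
`k = K, …, 1` in the downward induction of §3.A; (2.46) is stated for `k ≥ 1`); `k ≤ K`.  (vi) The terms 5–12 of (3.9) (cross terms,
`f′_k`, `f″_k`, `H′_k`, `H″_k`, `F′_k`, `F″_k`) are not objects of this file ((3.8)/(3.10)/(3.12): rows B2.Eq2.109, B2.Eq3.11's (3.12)
files `B2Ineq312OperatorNorm`, `B2Sect3AGaussianStep`).  No row head changes are claimed (owner r02).  Nothing here is summit progress.
-/

noncomputable section

open scoped BigOperators InnerProductSpace

namespace Literature.MathematicalPhysics.QuantumFieldTheory.Balaban1983to89.B2Eq39ConcreteForms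

open Literature.MathematicalPhysics.QuantumFieldTheory.Balaban1983to89
open HiggsLattice HiggsAveraging HiggsCovariance HiggsCovariancePos HiggsCovarianceCont HiggsFluctMeasure HiggsFluctMeasurePos
  B1Eq27StepAdjoint B1Eq230FluctCov B1Eq230FluctCovPos HiggsCondCov232 B2Eq255Concrete B2Eq227CondDelta

variable {P : HiggsLattice.Params} {N : ℕ}

/-! ## §1 (3.11) for the CONDITIONAL renormalization-group operator `Δ^{(k+1)}_Λ(Ω, A)` of (2.27)/(2.46) -/

section Arithmetic

/-- The map `(β, μ) ↦ βμ/(β + μ)` (half the harmonic mean) is monotone in both arguments on the positive quadrant: for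
`0 < β₀ ≤ β`, `0 < μ₀ ≤ μ`, `β₀μ₀/(β₀ + μ₀) ≤ βμ/(β + μ)`. [folklore] [cite: Balaban1982Higgs2, (3.11) p.585] -/
theorem hmean_mono {β₀ β μ₀ μ : ℝ} (hβ₀ : 0 < β₀) (hβ : β₀ ≤ β) (hμ₀ : 0 < μ₀) (hμ : μ₀ ≤ μ) :
    β₀ * μ₀ / (β₀ + μ₀) ≤ β * μ / (β + μ) := by
  have hβ' : 0 < β := lt_of_lt_of_le hβ₀ hβ
  have hμ' : 0 < μ := lt_of_lt_of_le hμ₀ hμ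
  rw [div_le_div_iff₀ (by positivity) (by positivity)]
  nlinarith [mul_nonneg (mul_nonneg hβ₀.le hβ'.le) (sub_nonneg.2 hμ), mul_nonneg (mul_nonneg hμ₀.le hμ'.le) (sub_nonneg.2 hβ)]

end Arithmetic

section CondDelta

variable (C : ChargeData N) (Ω : Finset (HiggsLattice.Site P 0)) (A : HiggsLattice.VecField P 0)

/-- `B(Λ′)·Q^*(A)ψ = Q^*(A)(Λ′ψ)`: cutting the covariantly block-constant extension to the union of blocks `B(Λ′)` is extending the
cut field (`(Q^*(A)ψ)(x) = U^*ψ(x₁)` reads `ψ` at the block point `x₁` only). [cite: Balaban1982Higgs1, (2.32) p.611] -/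
theorem cutTo_blockSet_avgQAdjLin (k : ℕ) (Λ' : Finset (HiggsLattice.Site P (k + 1))) (ψ : ScalarField P (k + 1) N) :
    cutTo (blockSet Λ') (avgQAdjLin C A k ψ) = avgQAdjLin C A k (cutTo Λ' ψ) := by
  funext x
  by_cases hx : HiggsLattice.blockOf x ∈ Λ'
  · rw [cutTo_of_mem _ _ ((mem_blockSet Λ' x).2 hx), avgQAdjLin_apply, avgQAdjLin_apply, cutTo_of_mem _ _ hx]
  · rw [cutTo_of_not_mem _ _ (fun h => hx ((mem_blockSet Λ' x).1 h)), avgQAdjLin_apply, cutTo_of_not_mem _ _ hx,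
      map_zero]

/-- **(3.11) FOR THE CONDITIONAL OPERATOR `Δ^{(k+1),L^{k+1}ε}_Λ(Ω, A)` OF (2.27), from a mass-term lower bound of the fundamental
operator one level down** (*"it suffices to use the mass terms in the fundamental operators"*): if `μ·⟨φ,φ⟩ ≤ ⟨φ, Δ^{(k)}(Ω,A)φ⟩` for
all `φ` on `T^{(k)}` (`μ ≥ 0`), then for EVERY `Λ′ ⊂ T^{(k+1)}` and EVERY `ψ` on `T^{(k+1)}`,
`[βμ/(β + μ)]·⟨Λ′ψ, Λ′ψ⟩ ≤ ⟨ψ, Δ^{(k+1)}_Λ(Ω,A)ψ⟩`, `β = a(L^{k+1}ε)^{−2}`, `Λ = B(Λ′)` (m² > 0, a > 0, L > 1, `k < K`; every coupling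
`C`, region `Ω`, external field `A`).  Proof = the five lines of the module header: `w = Q^*(Λ′ψ)`, `φ = C^{(k)}_Λw`,
`X = ⟨w, φ⟩ = β|Qφ|² + ⟨φ, Δ^{(k)}φ⟩ ≥ (β + μ)|Qφ|²`, `X = ⟨Λ′ψ, Qφ⟩ ≤ |Λ′ψ||Qφ|`, `(β + μ)X ≤ |Λ′ψ|²`, (2.27).
[cite: Balaban1982Higgs2, (3.11) p.585, (2.27) p.562] [cite: Balaban1982Higgs1, (2.32) p.611] -/
theorem siteInner_condDelta227_ge_of_lower {msq a : ℝ} (hmsq : 0 < msq) (ha : 0 < a) (hL : 1 < (P.L : ℝ)) {k : ℕ}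
    (hk : k < P.K) {μ : ℝ} (hμ : 0 ≤ μ)
    (hlow : ∀ φ : ScalarField P k N, μ * siteInner φ φ ≤ siteInner φ (deltaKA C Ω A msq a k φ))
    (Λ' : Finset (HiggsLattice.Site P (k + 1))) (ψ : ScalarField P (k + 1) N) :
    stepCoef P a k * μ / (stepCoef P a k + μ) * siteInner (cutTo Λ' ψ) (cutTo Λ' ψ)
      ≤ siteInner ψ (condDelta227 C Ω A msq a k Λ' ψ) := by
  have hβ : 0 < stepCoef P a k := stepCoef_pos ha k
  set β : ℝ := stepCoef P a k with hβ_def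
  set Λ : Finset (HiggsLattice.Site P k) := blockSet Λ' with hΛ_def
  set ψ' : ScalarField P (k + 1) N := cutTo Λ' ψ with hψ'_def
  set w : ScalarField P k N := avgQAdjLin C A k ψ' with hw_def
  set φ : ScalarField P k N := condCov232 C Ω A msq a k Λ w with hφ_def
  set s : ℝ := siteInner ψ' ψ' with hs_def
  set u : ℝ := siteInner (avgQLin C A k φ) (avgQLin C A k φ) with hu_def
  set X : ℝ := siteInner w φ with hX_def
  have hs : 0 ≤ s := siteInner_self_nonneg ψ'
  have hu : 0 ≤ u := siteInner_self_nonneg _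
  -- `w = Λ(Q^*ψ)` is supported in `Λ`, and `C_Λ(Q^*ψ) = C_Λw = φ`
  have hw_cut : cutTo Λ (avgQAdjLin C A k ψ) = w := by
    rw [hw_def, hψ'_def, hΛ_def, cutTo_blockSet_avgQAdjLin]
  have hwΛ : cutTo Λ w = w := by rw [← hw_cut, cutTo_cutTo]
  have hφ_eq : condCov232 C Ω A msq a k Λ (avgQAdjLin C A k ψ) = φ := by
    rw [← condCov232_cutTo, hw_cut]
  -- `φ` is supported in `Λ`
  have hφΛ : cutTo Λ φ = φ := by
    show cutTo Λ (restrictInv Λ (precOpA C Ω A msq a k) w) = restrictInv Λ (precOpA C Ω A msq a k) w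
    rw [restrictInv_apply, cutTo_cutTo]
  -- (2.27): `⟨ψ, Δ_Λψ⟩ = β s − β² X`
  have h227 : siteInner ψ (condDelta227 C Ω A msq a k Λ' ψ) = β * s - β ^ 2 * X := by
    rw [siteInner_condDelta227, ← hβ_def, ← hΛ_def, ← hψ'_def, ← hs_def, hφ_eq]
    congr 1
    rw [hX_def, ← hφΛ, siteInner_cutTo Λ (avgQAdjLin C A k ψ), hw_cut, hφΛ]
  -- `ΛMφ = w`, hence `X = ⟨φ, Mφ⟩`
  have hMφ : restrictOp Λ (precOpA C Ω A msq a k) φ = w := by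
    rw [hφ_def, restrictOp_precOpA_condCov232_apply C Ω A hmsq ha hL hk.le Λ w, hwΛ]
  have hXM : X = siteInner φ (precOpA C Ω A msq a k φ) := by
    have h3 : siteInner φ (restrictOp Λ (precOpA C Ω A msq a k) φ)
        = siteInner (cutTo Λ φ) (precOpA C Ω A msq a k (cutTo Λ φ)) := siteInner_restrictOp Λ _ φ φ
    rw [hφΛ, hMφ] at h3
    rw [hX_def, siteInner_comm, h3]
  -- `⟨φ, Mφ⟩ = β u + ⟨φ, Δ^{(k)}φ⟩ ≥ (β + μ) u` (mass term + Jensen)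
  have hXsplit : X = β * u + siteInner φ (deltaKA C Ω A msq a k φ) := by
    rw [hXM, precOpA_eq, ← hβ_def, LinearMap.add_apply, LinearMap.smul_apply, siteInner_add_right, siteInner_smul_right,
      siteInner_blockProjA_eq]
  have hJ : u ≤ siteInner φ φ := B2Ineq311CondDelta.siteInner_avgQLin_self_le C A hk φ
  have hXge : (β + μ) * u ≤ X := by
    rw [hXsplit]
    have h1 := hlow φ
    nlinarith [mul_le_mul_of_nonneg_left hJ hμ]
  -- `X = ⟨ψ′, Qφ⟩ ≤ |ψ′||Qφ|`, hence `X² ≤ s u`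
  have hadj : X = siteInner ψ' (avgQLin C A k φ) := by
    rw [hX_def, hw_def, siteInner_comm, ← siteInner_avgQLin, siteInner_comm]
  have hXsq : X ^ 2 ≤ s * u := by
    rw [hadj]
    have habs := abs_siteInner_le ψ' (avgQLin C A k φ)
    have hprod : 0 ≤ sNorm ψ' * sNorm (avgQLin C A k φ) := mul_nonneg (sNorm_nonneg _) (sNorm_nonneg _)
    calc siteInner ψ' (avgQLin C A k φ) ^ 2
        = |siteInner ψ' (avgQLin C A k φ)| ^ 2 := (sq_abs _).symm
      _ ≤ (sNorm ψ' * sNorm (avgQLin C A k φ)) ^ 2 := by gcongr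
      _ = s * u := by rw [mul_pow, sNorm_sq, sNorm_sq]
  -- hence `(β + μ) X ≤ s`
  have hX0 : 0 ≤ X := le_trans (mul_nonneg (by positivity) hu) hXge
  have hkey : (β + μ) * X ≤ s := by
    rcases hX0.lt_or_eq with hXpos | hX0'
    · have h1 : (β + μ) * X ^ 2 ≤ s * X := by
        calc (β + μ) * X ^ 2 ≤ (β + μ) * (s * u) := mul_le_mul_of_nonneg_left hXsq (by positivity)
          _ = s * ((β + μ) * u) := by ring
          _ ≤ s * X := mul_le_mul_of_nonneg_left hXge hs
      by_contra hnot
      push Not at hnot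
      have : s * X < (β + μ) * X * X := mul_lt_mul_of_pos_right hnot hXpos
      nlinarith
    · rw [← hX0']; simpa using hs
  -- conclusion: `βμ/(β+μ)·s ≤ β s − β² X`
  rw [h227]
  have hβμ : 0 < β + μ := by positivity
  rw [div_mul_eq_mul_div, div_le_iff₀ hβμ]
  nlinarith [mul_pos hβ hβ, hkey, hX0]

/-- **(3.11) for `Δ^{(1),Lε}_Λ(Ω, A)`** (the first conditional step, `k = 0`): the fundamental operator is `Δ^{(0),ε}(Ω,A) =
−Δ^{ε,N}_{A,Ω} + m² ≥ m²` ((I.2.17); p35's `siteInner_deltaKA_zero_ge`), so `[βm²/(β + m²)]·⟨Λ′ψ,Λ′ψ⟩ ≤ ⟨ψ, Δ^{(1)}_Λ(Ω,A)ψ⟩`,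
`β = a(Lε)^{−2}` (m² > 0, a > 0, L > 1, K ≥ 1). [cite: Balaban1982Higgs2, (3.11) p.585, (2.27) p.562] [cite: Balaban1982Higgs1, (2.17) p.610] -/
theorem siteInner_condDelta227_zero_ge {msq a : ℝ} (hmsq : 0 < msq) (ha : 0 < a) (hL : 1 < (P.L : ℝ)) (hK : 0 < P.K)
    (Λ' : Finset (HiggsLattice.Site P (0 + 1))) (ψ : ScalarField P (0 + 1) N) :
    stepCoef P a 0 * msq / (stepCoef P a 0 + msq) * siteInner (cutTo Λ' ψ) (cutTo Λ' ψ)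
      ≤ siteInner ψ (condDelta227 C Ω A msq a 0 Λ' ψ) :=
  siteInner_condDelta227_ge_of_lower C Ω A hmsq ha hL hK hmsq.le (fun φ => siteInner_deltaKA_zero_ge C Ω A msq a φ) Λ' ψ

/-- **(3.11) for `Δ^{(k+1),L^{k+1}ε}_Λ(Ω, A)`, `k = i + 1 ≥ 1`**: with r02 g7's mass-term bound for the fundamental operator
`Δ^{(k)}(Ω,A)` one level down (`μ = c·m²/(c + m²)`, `c = a_k(Lᵏε)^{−2}`, `B2Ineq311DeltaKConcrete.siteInner_deltaKA_succ_ge`),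
`[βμ/(β + μ)]·⟨Λ′ψ,Λ′ψ⟩ ≤ ⟨ψ, Δ^{(k+1)}_Λ(Ω,A)ψ⟩`, `β = a(L^{k+1}ε)^{−2}` (m² > 0, a > 0, L > 1, `k < K`).
[cite: Balaban1982Higgs2, (3.11) p.585, (2.27) p.562] [cite: Balaban1982Higgs1, (2.21) p.610] -/
theorem siteInner_condDelta227_succ_ge {msq a : ℝ} (hmsq : 0 < msq) (ha : 0 < a) (hL : 1 < (P.L : ℝ)) {i : ℕ}
    (hi : i + 1 < P.K) (Λ' : Finset (HiggsLattice.Site P (i + 1 + 1))) (ψ : ScalarField P (i + 1 + 1) N) :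
    stepCoef P a (i + 1) * (coeff221 P a (i + 1) * msq / (coeff221 P a (i + 1) + msq))
        / (stepCoef P a (i + 1) + coeff221 P a (i + 1) * msq / (coeff221 P a (i + 1) + msq))
        * siteInner (cutTo Λ' ψ) (cutTo Λ' ψ)
      ≤ siteInner ψ (condDelta227 C Ω A msq a (i + 1) Λ' ψ) := by
  have hc : 0 < coeff221 P a (i + 1) := coeff221_pos ha hL (Nat.succ_le_succ (Nat.zero_le i))
  exact siteInner_condDelta227_ge_of_lower C Ω A hmsq ha hL hi (by positivity)
    (fun φ => B2Ineq311DeltaKConcrete.siteInner_deltaKA_succ_ge C Ω A hmsq ha hL hi.le φ) Λ' ψ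

/-- The uniform constant: with `a_∞ = a(1 − L⁻²)`, `β ≥ a_∞` and `μ ≥ [a_∞/(a_∞ + m²)]m²` give `βμ/(β + μ) ≥ [a_∞/(a_∞ + 2m²)]m²`
(`hmean_mono` and the identity `a_∞·μ_∞/(a_∞ + μ_∞) = a_∞m²/(a_∞ + 2m²)` for `μ_∞ = a_∞m²/(a_∞ + m²)`).
[cite: Balaban1982Higgs2, (3.11) p.585] [cite: Balaban1982Higgs1, (2.15) p.609] -/
theorem gamma1_cond_le {a msq β μ : ℝ} {L : ℕ} (ha : 0 < a) (hL : 1 < (L : ℝ)) (hmsq : 0 < msq)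
    (hβ : a * (1 - ((L : ℝ) ^ 2)⁻¹) ≤ β) (hμ : a * (1 - ((L : ℝ) ^ 2)⁻¹) / (a * (1 - ((L : ℝ) ^ 2)⁻¹) + msq) * msq ≤ μ) :
    a * (1 - ((L : ℝ) ^ 2)⁻¹) / (a * (1 - ((L : ℝ) ^ 2)⁻¹) + 2 * msq) * msq ≤ β * μ / (β + μ) := by
  have hainf : 0 < a * (1 - ((L : ℝ) ^ 2)⁻¹) := by
    have hL2 : 1 < (L : ℝ) ^ 2 := by nlinarith
    have : ((L : ℝ) ^ 2)⁻¹ < 1 := inv_lt_one_of_one_lt₀ hL2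
    exact mul_pos ha (by linarith)
  set α : ℝ := a * (1 - ((L : ℝ) ^ 2)⁻¹) with hα
  have hμ0 : 0 < α / (α + msq) * msq := by positivity
  have h := hmean_mono hainf hβ hμ0 hμ
  have hid : α * (α / (α + msq) * msq) / (α + α / (α + msq) * msq) = α / (α + 2 * msq) * msq := by
    have h1 : α + msq ≠ 0 := by positivity
    have h2 : α + 2 * msq ≠ 0 := by positivity
    field_simp
    ring
  rw [hid] at h
  exact h

/-- **(3.11) for the conditional operators with ONE `γ₁` for all steps, volumes, regions and fields**: for m² > 0, a > 0,
L > 1, every `k < K` with `L^{k+1}ε ≤ 1`, every coupling `C`, region `Ω`, external field `A`, index set `Λ′ ⊂ T^{(k+1)}` and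
field `ψ` on `T^{(k+1)}`: `γ₁·m²·⟨Λ′ψ, Λ′ψ⟩ ≤ ⟨ψ, Δ^{(k+1),L^{k+1}ε}_Λ(Ω,A)ψ⟩` with `γ₁ = a_∞/(a_∞ + 2m²)`, `a_∞ = a(1 − L⁻²)` — the
printed `G″_k ≧ γ₁m²(Lᵏε)²I↾` for the Δ-block of (3.9) in physical units. [cite: Balaban1982Higgs2, (3.11) p.585, (2.46) p.567] -/
theorem siteInner_condDelta227_ge_uniform {msq a : ℝ} (hmsq : 0 < msq) (ha : 0 < a) (hL : 1 < (P.L : ℝ)) {k : ℕ}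
    (hk : k < P.K) (hs : P.mesh (k + 1) ≤ 1) (Λ' : Finset (HiggsLattice.Site P (k + 1))) (ψ : ScalarField P (k + 1) N) :
    a * (1 - ((P.L : ℝ) ^ 2)⁻¹) / (a * (1 - ((P.L : ℝ) ^ 2)⁻¹) + 2 * msq) * msq * siteInner (cutTo Λ' ψ) (cutTo Λ' ψ)
      ≤ siteInner ψ (condDelta227 C Ω A msq a k Λ' ψ) := by
  have hainf : 0 < a * (1 - ((P.L : ℝ) ^ 2)⁻¹) := by
    have hL2 : 1 < (P.L : ℝ) ^ 2 := by nlinarith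
    have : ((P.L : ℝ) ^ 2)⁻¹ < 1 := inv_lt_one_of_one_lt₀ hL2
    exact mul_pos ha (by linarith)
  set μ : ℝ := a * (1 - ((P.L : ℝ) ^ 2)⁻¹) / (a * (1 - ((P.L : ℝ) ^ 2)⁻¹) + msq) * msq with hμ_def
  have hμ0 : 0 ≤ μ := by positivity
  -- the fundamental operator one level down is bounded below by `μ`
  have hlow : ∀ φ : ScalarField P k N, μ * siteInner φ φ ≤ siteInner φ (deltaKA C Ω A msq a k φ) := by
    intro φ
    cases k with
    | zero =>
      have h0 := siteInner_deltaKA_zero_ge C Ω A msq a φ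
      have hle : μ ≤ msq := by
        rw [hμ_def, div_mul_eq_mul_div, div_le_iff₀ (by positivity)]
        nlinarith [hmsq, hainf]
      exact le_trans (mul_le_mul_of_nonneg_right hle (siteInner_self_nonneg φ)) h0
    | succ i =>
      have hs' : P.mesh (i + 1) ≤ 1 := (B2Prop31ZeroFieldConcrete.mesh_le_mesh (Nat.le_succ _)).trans hs
      exact B2Ineq311DeltaKConcrete.siteInner_deltaKA_succ_ge_uniform C Ω A hmsq ha hL hk.le hs' φ
  have hmain := siteInner_condDelta227_ge_of_lower C Ω A hmsq ha hL hk hμ0 hlow Λ' ψ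
  -- `β = a(L^{k+1}ε)^{−2} ≥ a ≥ a_∞`
  have hβ : a * (1 - ((P.L : ℝ) ^ 2)⁻¹) ≤ stepCoef P a k := by
    have hm0 : 0 < P.mesh (k + 1) := P.mesh_pos (k + 1)
    have hinv : 1 ≤ (P.mesh (k + 1))⁻¹ := one_le_inv_iff₀.2 ⟨hm0, hs⟩
    have hinv2 : 1 ≤ (P.mesh (k + 1))⁻¹ ^ 2 := by nlinarith
    have hL2 : 0 < ((P.L : ℝ) ^ 2)⁻¹ := by positivity
    calc a * (1 - ((P.L : ℝ) ^ 2)⁻¹) ≤ a * 1 := by nlinarith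
      _ ≤ a * (P.mesh (k + 1))⁻¹ ^ 2 := by nlinarith
      _ = stepCoef P a k := (stepCoef_eq a k).symm
  have hγ := gamma1_cond_le (β := stepCoef P a k) (μ := μ) ha hL hmsq hβ le_rfl
  exact le_trans (mul_le_mul_of_nonneg_right hγ (siteInner_self_nonneg _)) hmain

/-- **The VECTOR species** (the third term of (3.9): `Δ^{(k)}_{Λ₅^{(k−1)}}` for the vector field — p. 562 *"the similar formula
holds for the vector field"*, part I p. 608 *"N = d and an external vector field A = 0"*; the typer's `condDelta227_zero_field`):
`γ₁·μ₀²·⟨Λ′B, Λ′B⟩ ≤ ⟨B, Δ^{(k+1)}_ΛB⟩`, `γ₁ = a_∞/(a_∞ + 2μ₀²)`, fundamental operator `−Δ^η + μ₀²`.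
[cite: Balaban1982Higgs2, (3.11) p.585, (2.27) p.562] -/
theorem siteInner_condDelta227_vec_ge_uniform {μ0sq a : ℝ} (hμ : 0 < μ0sq) (ha : 0 < a) (hL : 1 < (P.L : ℝ)) {k : ℕ}
    (hk : k < P.K) (hs : P.mesh (k + 1) ≤ 1) (Λ' : Finset (HiggsLattice.Site P (k + 1))) (B : ScalarField P (k + 1) P.d) :
    a * (1 - ((P.L : ℝ) ^ 2)⁻¹) / (a * (1 - ((P.L : ℝ) ^ 2)⁻¹) + 2 * μ0sq) * μ0sq * siteInner (cutTo Λ' B) (cutTo Λ' B)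
      ≤ siteInner B (condDelta227 (B3MultiscaleFields.zeroCharge P.d) Finset.univ (0 : HiggsLattice.VecField P 0)
          μ0sq a k Λ' B) :=
  siteInner_condDelta227_ge_uniform _ _ _ hμ ha hL hk hs Λ' B

end CondDelta

/-! ## §2 The composite averaging `Q_n(A)` started at level `k`: `T^{(k)} → T^{(k+n)}` -/

section Iter

variable (C : ChargeData N) (A : HiggsLattice.VecField P 0)

/-- **`Q_n(A)` started at level `k`**: the composite `Q(A)∘⋯∘Q(A)` of `n` one-step covariant averagings (I (2.7)), from the
fields on `T^{(k)}` to the fields on `T^{(k+n)}` — the operators `Q_{l−k}(Ã)` of (3.9) (`l = k + n`), composed *"according to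
formula (I.2.12)"* (p. 584; at `k = 0` this is the tree's `avgQkLin`, `B1Eq27StepAdjoint.avgQLin_comp_avgQkLin`).
[cite: Balaban1982Higgs2, (3.9) p.585] [cite: Balaban1982Higgs1, (2.12) p.609] -/
def avgQIter (k : ℕ) : (n : ℕ) → (ScalarField P k N →ₗ[ℝ] ScalarField P (k + n) N)
  | 0 => LinearMap.id
  | n + 1 => avgQLin C A (k + n) ∘ₗ avgQIter k n

/-- `Q_0 = 1`. [cite: Balaban1982Higgs2, (3.9) p.585] -/
theorem avgQIter_zero (k : ℕ) : avgQIter C A k 0 = LinearMap.id := rfl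

/-- `Q_{n+1} = Q ∘ Q_n` (I (2.14) started at level `k`). [cite: Balaban1982Higgs1, (2.14) p.609] -/
theorem avgQIter_succ (k n : ℕ) : avgQIter C A k (n + 1) = avgQLin C A (k + n) ∘ₗ avgQIter C A k n := rfl

/-- `Q_1 = Q` (one step). [cite: Balaban1982Higgs1, (2.7) p.608] -/
theorem avgQIter_one (k : ℕ) : avgQIter C A k 1 = avgQLin C A k :=
  LinearMap.ext fun _ => rfl

end Iter

/-! ## §3 The quadratic forms `⟨B, G′_kB⟩`, `⟨B, G″_kB⟩` of (3.9) as concrete objects -/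

/-- **The geometry of ONE integral (3.9)** at the level `k = j + 1` (`1 ≤ k ≤ K`): the index set `Λc ↤ Λ₅^{(k−1)′} ⊂ T^{(k)}` of the
conditioning region `Λ₅^{(k−1)} = B(Λ₅^{(k−1)′})` of (2.46), the region `Λ5 ↤ Λ₅⁽ᵏ⁾ ⊂ T^{(k)}` carrying the integrated fields
`A_k↾_{Λ₅⁽ᵏ⁾}`, `φ_k↾_{Λ₅⁽ᵏ⁾}`, nested in it ((3.22): `B(Λ₅⁽ᵏ⁾) ⊂ Λ₅^{(k−1)}`), and the higher regions `reg n ↤ Λ₅^{(l−1)′}∩Λ₅^{(l)c} ⊂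
T^{(l)}`, `l = k + n`, `n = 1, …, M` (`M ↤ K − k`), over which the first two terms of (3.9) are summed.
[cite: Balaban1982Higgs2, (3.9) p.585, (2.46) p.567, (3.22) p.588] -/
structure Geom39 (P : HiggsLattice.Params) where
  /-- `k = j + 1` is the level of the fields integrated in (3.9) -/
  j : ℕ
  hj : j + 1 ≤ P.K
  /-- `Λ₅^{(k−1)′}`: the blocks of the conditioning region `Λ₅^{(k−1)}` -/
  Λc : Finset (HiggsLattice.Site P (j + 1))
  /-- `Λ₅⁽ᵏ⁾` -/
  Λ5 : Finset (HiggsLattice.Site P (j + 1))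
  /-- `B(Λ₅⁽ᵏ⁾) ⊂ Λ₅^{(k−1)}` -/
  nested : Λ5 ⊆ Λc
  /-- number of higher levels, `K − k` -/
  M : ℕ
  hM : j + 1 + M ≤ P.K
  /-- `Λ₅^{(k+n−1)′} ∩ Λ₅^{(k+n)c} ⊂ T^{(k+n)}`, `n = 1, …, M` -/
  reg : (n : ℕ) → Finset (HiggsLattice.Site P (j + 1 + n))

namespace Geom39

variable (G : Geom39 P) (C : ChargeData N) (Ω : Finset (HiggsLattice.Site P 0)) (AΔ AQ : HiggsLattice.VecField P 0)
  (msq a : ℝ)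

/-- **The averaging squares of (3.9)** (quadratic part of the first resp. second term in the integrated field `B = A_k↾_{Λ₅⁽ᵏ⁾}`
resp. `φ_k↾_{Λ₅⁽ᵏ⁾}`): `Σ_{n=1}^{M} a_n·(L^{k+n}ε)^{−2}·‖Λ_{k+n}·Q_n(A_Q)(Λ₅⁽ᵏ⁾B)‖²_{T^{(k+n)}}` — in the print's unit-lattice letters
`Σ_{l=k+1}^{K} a_{l−k}(L^{l−k})^{d−2}Σ_{x_l∈Λ₅^{(l−1)′}∩Λ₅^{(l)c}}|(Q_{l−k}(Ã)B)(x_l)|²` (`a_n = B1.aSeq a L n` of (I.2.15)).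
[cite: Balaban1982Higgs2, (3.9) p.585] -/
def sqForm39 (B : ScalarField P (G.j + 1) N) : ℝ :=
  ∑ n ∈ Finset.Icc 1 G.M, B1.aSeq a P.L n * (P.mesh (G.j + 1 + n))⁻¹ ^ 2 *
    siteInner (cutTo (G.reg n) (avgQIter C AQ (G.j + 1) n (cutTo G.Λ5 B)))
      (cutTo (G.reg n) (avgQIter C AQ (G.j + 1) n (cutTo G.Λ5 B)))

/-- **`⟨B, G_kB⟩` OF (3.9)** — *"the quadratic forms in A_k, φ_k, connected with the first four terms in the exponential under the
integral (3.9)"*: the averaging squares PLUS the block `⟨Λ₅⁽ᵏ⁾B, Δ^{(k)}_{Λ₅^{(k−1)}}(Ω, A_Δ)Λ₅⁽ᵏ⁾B⟩` of the CONDITIONAL operator of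
(2.46)/(2.27) (`condDelta227` at the typer index `j = k − 1`, conditioning blocks `Λ₅^{(k−1)′}`).  Scalar species `G″_k`: `(C, Ω =
Bᵏ(Λ₂^{(k−1)′}), A_Δ = Ã^{(k)}, A_Q = Ã^{(k+1)}, m²)`; vector species `G′_k`: trivial coupling, `Ω = T`, `A_Δ = A_Q = 0`, mass `μ₀²`.
[cite: Balaban1982Higgs2, (3.9) p.585, (2.46) p.567] -/
def form39 (B : ScalarField P (G.j + 1) N) : ℝ :=
  G.sqForm39 C AQ a B + siteInner (cutTo G.Λ5 B) (condDelta227 C Ω AΔ msq a G.j G.Λc (cutTo G.Λ5 B))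

/-- Unfolding of `form39` (definitional). [cite: Balaban1982Higgs2, (3.9) p.585] -/
theorem form39_eq (B : ScalarField P (G.j + 1) N) :
    G.form39 C Ω AΔ AQ msq a B
      = (∑ n ∈ Finset.Icc 1 G.M, B1.aSeq a P.L n * (P.mesh (G.j + 1 + n))⁻¹ ^ 2 *
          siteInner (cutTo (G.reg n) (avgQIter C AQ (G.j + 1) n (cutTo G.Λ5 B)))
            (cutTo (G.reg n) (avgQIter C AQ (G.j + 1) n (cutTo G.Λ5 B))))
        + siteInner (cutTo G.Λ5 B) (condDelta227 C Ω AΔ msq a G.j G.Λc (cutTo G.Λ5 B)) := rfl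

/-- The averaging squares are `≥ 0` (`a_n > 0` for `n ≥ 1`, a > 0, L > 1). [cite: Balaban1982Higgs2, (3.9) p.585] -/
theorem sqForm39_nonneg {a : ℝ} (ha : 0 < a) (hL : 1 < (P.L : ℝ)) (B : ScalarField P (G.j + 1) N) :
    0 ≤ G.sqForm39 C AQ a B := by
  refine Finset.sum_nonneg fun n hn => ?_
  have hn1 : 1 ≤ n := (Finset.mem_Icc.mp hn).1
  exact mul_nonneg (mul_nonneg (B1.aSeq_pos ha hL hn1).le (pow_nonneg (inv_nonneg.2 (P.mesh_pos _).le) 2))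
    (siteInner_self_nonneg _)

/-- `Λ₅^{(k−1)′}(Λ₅⁽ᵏ⁾B) = Λ₅⁽ᵏ⁾B` (the region is nested in the conditioning blocks). [cite: Balaban1982Higgs2, (3.22) p.588] -/
theorem cutTo_Λc_cutTo_Λ5 (B : ScalarField P (G.j + 1) N) : cutTo G.Λc (cutTo G.Λ5 B) = cutTo G.Λ5 B := by
  funext x
  by_cases hx : x ∈ G.Λ5
  · rw [cutTo_of_mem _ _ (G.nested hx)]
  · rw [cutTo_of_not_mem G.Λ5 B hx]
    by_cases hx' : x ∈ G.Λc
    · rw [cutTo_of_mem _ _ hx', cutTo_of_not_mem G.Λ5 B hx]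
    · rw [cutTo_of_not_mem _ _ hx']

/-! ## §4 (3.11) for the forms of (3.9) -/

/-- **(3.11) `G″_k ≧ γ₁m²(Lᵏε)²I↾_{Λ₅⁽ᵏ⁾}` FOR THE CONCRETE FORM OF (3.9)** (physical units: `γ₁·m²·‖Λ₅⁽ᵏ⁾B‖² ≤ ⟨B, G″_kB⟩`), by the
printed mechanism: the averaging squares are `≥ 0` and the Δ-block is bounded below through *"the mass terms in the fundamental
operators"* (`siteInner_condDelta227_ge_uniform`) — for EVERY geometry `G`, coupling `C`, region `Ω`, external fields `A_Δ`, `A_Q`,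
field `B` on `T^{(k)}`; m² > 0, a > 0, L > 1, `Lᵏε ≤ 1`; ONE `γ₁ = a_∞/(a_∞ + 2m²)`, `a_∞ = a(1 − L⁻²)`, for all steps and volumes.
[cite: Balaban1982Higgs2, (3.11) p.585, (3.9) p.585] -/
theorem ineq311_form39 {msq a : ℝ} (hmsq : 0 < msq) (ha : 0 < a) (hL : 1 < (P.L : ℝ)) (hs : P.mesh (G.j + 1) ≤ 1)
    (B : ScalarField P (G.j + 1) N) :
    a * (1 - ((P.L : ℝ) ^ 2)⁻¹) / (a * (1 - ((P.L : ℝ) ^ 2)⁻¹) + 2 * msq) * msq * siteInner (cutTo G.Λ5 B) (cutTo G.Λ5 B)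
      ≤ G.form39 C Ω AΔ AQ msq a B := by
  have hΔ := siteInner_condDelta227_ge_uniform C Ω AΔ hmsq ha hL (Nat.lt_of_succ_le G.hj) hs G.Λc (cutTo G.Λ5 B)
  rw [G.cutTo_Λc_cutTo_Λ5] at hΔ
  have hsq := G.sqForm39_nonneg C AQ ha hL B
  rw [form39]
  linarith

/-- **(3.11) `G′_k ≧ γ₁μ₀²(Lᵏε)²I↾_{Λ₅⁽ᵏ⁾}` FOR THE VECTOR SPECIES** (trivial coupling, `Ω = T`, zero external fields, mass `μ₀²`;
fundamental operator `−Δ^η + μ₀²`): `γ₁·μ₀²·‖Λ₅⁽ᵏ⁾B‖² ≤ ⟨B, G′_kB⟩`, `γ₁ = a_∞/(a_∞ + 2μ₀²)`.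
[cite: Balaban1982Higgs2, (3.11) p.585, (3.9) p.585] -/
theorem ineq311_form39_vec {μ0sq a : ℝ} (hμ : 0 < μ0sq) (ha : 0 < a) (hL : 1 < (P.L : ℝ)) (hs : P.mesh (G.j + 1) ≤ 1)
    (B : ScalarField P (G.j + 1) P.d) :
    a * (1 - ((P.L : ℝ) ^ 2)⁻¹) / (a * (1 - ((P.L : ℝ) ^ 2)⁻¹) + 2 * μ0sq) * μ0sq * siteInner (cutTo G.Λ5 B) (cutTo G.Λ5 B)
      ≤ G.form39 (B3MultiscaleFields.zeroCharge P.d) Finset.univ (0 : HiggsLattice.VecField P 0)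
          (0 : HiggsLattice.VecField P 0) μ0sq a B :=
  G.ineq311_form39 _ _ _ _ hμ ha hL hs B

/-! ### (v1.1) The geometry of Bałaban's runs: from the §3 tower of large-field regions -/

/-- The pieces `Λ_{k+n} = Λ₅^{(k+n−1)′} ∖ Λ₅^{(k+n)} ⊂ T^{(k+n)}`, `k = j + 1`, of a tower of large-field regions, in the relative
indexing of `Geom39.reg` (`n = 0`: `Λ_k` itself, unused by `sqForm39`; `n + 1 ↦ Λ_{k+n+1}` = p15's `Tower.regions.block (k + n)`;
the levels `j + 1 + (n + 1)` and `(j + 1 + n) + 1` agree definitionally). [cite: Balaban1982Higgs2, (3.22)–(3.24) p.588] -/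
def towerPieceFrom {K : ℕ} (T : B2Eq324NestedRegions.Tower P K) (j : ℕ) : (n : ℕ) → Finset (HiggsLattice.Site P (j + 1 + n))
  | 0 => B2Eq324NestedRegions.prime (T.lam j) \ T.lam (j + 1)
  | n + 1 => B2Eq324NestedRegions.prime (T.lam (j + 1 + n)) \ T.lam (j + 1 + n + 1)

/-- `towerPieceFrom T j (n+1)` IS the region `Λ_{j+1+n+1}` of the tower's region data (definitional).
[cite: Balaban1982Higgs2, (3.24) p.588] -/
theorem towerPieceFrom_succ {K : ℕ} (T : B2Eq324NestedRegions.Tower P K) (j n : ℕ) (h : j + 1 + n < K) :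
    towerPieceFrom T j (n + 1) = T.regions.block ⟨j + 1 + n, h⟩ := rfl

/-- **THE GEOMETRY OF (3.9) FOR BAŁABAN'S TOWER** at the level `k = j + 1` (`1 ≤ k ≤ K ≤ P.K`): conditioning blocks `Λ₅^{(k−1)′}`
(`prime (T.lam j)`), region `Λ₅⁽ᵏ⁾ = T.lam (j+1)` — nested in `Λ₅^{(k−1)′}` by `Tower.nested` ((3.22) `B(Λ₅⁽ᵏ⁾) ⊂ Λ₅^{(k−1)}`) —,
`M = K − k` higher levels with the regions `Λ_{k+n} = Λ₅^{(k+n−1)′} ∖ Λ₅^{(k+n)}` (`towerPieceFrom`).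
[cite: Balaban1982Higgs2, (3.9) p.585, (3.22)–(3.24) p.588] -/
def ofTower {K : ℕ} (T : B2Eq324NestedRegions.Tower P K) (hK : K ≤ P.K) (j : ℕ) (hj : j + 1 ≤ K) : Geom39 P where
  j := j
  hj := hj.trans hK
  Λc := B2Eq324NestedRegions.prime (T.lam j)
  Λ5 := T.lam (j + 1)
  nested := fun y hy => (B2Eq324NestedRegions.mem_prime _ _).2 fun x hx => T.nested j (Nat.lt_of_succ_le hj) x (hx ▸ hy)
  M := K - (j + 1)
  hM := by omega
  reg := towerPieceFrom T j

/-- The level of `ofTower` (definitional). [cite: Balaban1982Higgs2, (3.9) p.585] -/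
theorem ofTower_j {K : ℕ} (T : B2Eq324NestedRegions.Tower P K) (hK : K ≤ P.K) (j : ℕ) (hj : j + 1 ≤ K) :
    (ofTower T hK j hj).j = j := rfl

/-- `Λ5` of `ofTower` is `Λ₅⁽ᵏ⁾` (definitional). [cite: Balaban1982Higgs2, (3.22) p.588] -/
theorem ofTower_Λ5 {K : ℕ} (T : B2Eq324NestedRegions.Tower P K) (hK : K ≤ P.K) (j : ℕ) (hj : j + 1 ≤ K) :
    (ofTower T hK j hj).Λ5 = T.lam (j + 1) := rfl

/-- `Λc` of `ofTower` is `Λ₅^{(k−1)′}` (definitional). [cite: Balaban1982Higgs2, (2.46) p.567] -/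
theorem ofTower_Λc {K : ℕ} (T : B2Eq324NestedRegions.Tower P K) (hK : K ≤ P.K) (j : ℕ) (hj : j + 1 ≤ K) :
    (ofTower T hK j hj).Λc = B2Eq324NestedRegions.prime (T.lam j) := rfl

/-- The conditioning REGION of `ofTower` is `Λ₅^{(k−1)}` itself: `B(Λ₅^{(k−1)′}) = Λ₅^{(k−1)}` (the region is a union of blocks,
`Tower.isUnion`; r02 g9's three-line remark). [cite: Balaban1982Higgs2, (2.46) p.567, (3.22) p.588] -/
theorem blockSet_prime_lam {K : ℕ} (T : B2Eq324NestedRegions.Tower P K) {j : ℕ} (hj : j + 1 ≤ K) :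
    blockSet (B2Eq324NestedRegions.prime (T.lam j)) = T.lam j := by
  ext x
  rw [mem_blockSet, B2Eq324NestedRegions.mem_prime]
  exact ⟨fun h => h x rfl, fun h x' hx' => (T.isUnion j (Nat.lt_of_succ_le hj) x' x hx').mpr h⟩

/-- The same for the `Λc` of `ofTower` (definitionally `prime (T.lam j)`). [cite: Balaban1982Higgs2, (2.46) p.567] -/
theorem blockSet_ofTower_Λc {K : ℕ} (T : B2Eq324NestedRegions.Tower P K) (hK : K ≤ P.K) (j : ℕ) (hj : j + 1 ≤ K) :
    blockSet (ofTower T hK j hj).Λc = T.lam j :=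
  blockSet_prime_lam T hj

/-- `M` of `ofTower` is `K − k` (definitional). [cite: Balaban1982Higgs2, (3.9) p.585] -/
theorem ofTower_M {K : ℕ} (T : B2Eq324NestedRegions.Tower P K) (hK : K ≤ P.K) (j : ℕ) (hj : j + 1 ≤ K) :
    (ofTower T hK j hj).M = K - (j + 1) := rfl

/-- The higher regions of `ofTower` ARE the tower's `Λ_{k+n+1}` (definitional). [cite: Balaban1982Higgs2, (3.24) p.588] -/
theorem ofTower_reg_succ {K : ℕ} (T : B2Eq324NestedRegions.Tower P K) (hK : K ≤ P.K) (j : ℕ) (hj : j + 1 ≤ K) (n : ℕ)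
    (h : j + 1 + n < K) : (ofTower T hK j hj).reg (n + 1) = T.regions.block ⟨j + 1 + n, h⟩ := rfl

/-- **(3.11) `G″_k ≧ γ₁m²(Lᵏε)²I↾_{Λ₅⁽ᵏ⁾}` FOR BAŁABAN'S TOWER**, every level `1 ≤ k ≤ K`: `γ₁·m²·‖Λ₅⁽ᵏ⁾B‖² ≤ ⟨B, G″_kB⟩` for the
(3.9) form built on the §3 tower of large-field regions (every `C`, `Ω`, `A_Δ`, `A_Q`; m² > 0, a > 0, L > 1, `Lᵏε ≤ 1`).
[cite: Balaban1982Higgs2, (3.11) p.585, (3.9) p.585] -/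
theorem ineq311_form39_tower {K : ℕ} (T : B2Eq324NestedRegions.Tower P K) (hK : K ≤ P.K) (j : ℕ) (hj : j + 1 ≤ K)
    {msq a : ℝ} (hmsq : 0 < msq) (ha : 0 < a) (hL : 1 < (P.L : ℝ)) (hs : P.mesh (j + 1) ≤ 1) (B : ScalarField P (j + 1) N) :
    a * (1 - ((P.L : ℝ) ^ 2)⁻¹) / (a * (1 - ((P.L : ℝ) ^ 2)⁻¹) + 2 * msq) * msq
        * siteInner (cutTo (T.lam (j + 1)) B) (cutTo (T.lam (j + 1)) B)
      ≤ (ofTower T hK j hj).form39 C Ω AΔ AQ msq a B :=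
  (ofTower T hK j hj).ineq311_form39 C Ω AΔ AQ hmsq ha hL hs B

/-- **(3.11) `G′_k ≧ γ₁μ₀²(Lᵏε)²I↾_{Λ₅⁽ᵏ⁾}` FOR BAŁABAN'S TOWER, vector species**. [cite: Balaban1982Higgs2, (3.11) p.585, (3.9) p.585] -/
theorem ineq311_form39_tower_vec {K : ℕ} (T : B2Eq324NestedRegions.Tower P K) (hK : K ≤ P.K) (j : ℕ) (hj : j + 1 ≤ K)
    {μ0sq a : ℝ} (hμ : 0 < μ0sq) (ha : 0 < a) (hL : 1 < (P.L : ℝ)) (hs : P.mesh (j + 1) ≤ 1) (B : ScalarField P (j + 1) P.d) :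
    a * (1 - ((P.L : ℝ) ^ 2)⁻¹) / (a * (1 - ((P.L : ℝ) ^ 2)⁻¹) + 2 * μ0sq) * μ0sq
        * siteInner (cutTo (T.lam (j + 1)) B) (cutTo (T.lam (j + 1)) B)
      ≤ (ofTower T hK j hj).form39 (B3MultiscaleFields.zeroCharge P.d) Finset.univ (0 : HiggsLattice.VecField P 0)
          (0 : HiggsLattice.VecField P 0) μ0sq a B :=
  (ofTower T hK j hj).ineq311_form39_vec hμ ha hL hs B

end Geom39

/-- **Non-vacuity of the geometry**: for every lattice family member with `K ≥ 1` and every level `1 ≤ k ≤ K` there is a geometry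
of (3.9) at that level (e.g. `Λ₅⁽ᵏ⁾ ⊂ Λ₅^{(k−1)′}` both the whole lattice, `M = K − k` higher levels with empty regions — the top of
the induction of §3.A has `Λ₅⁽ᴷ⁾ = ∅`). [cite: Balaban1982Higgs2, (3.9) p.585] -/
theorem exists_geom39 {j : ℕ} (hj : j + 1 ≤ P.K) : ∃ G : Geom39 P, G.j = j ∧ G.M = P.K - (j + 1) :=
  ⟨{ j := j, hj := hj, Λc := Finset.univ, Λ5 := Finset.univ, nested := fun _ h => h, M := P.K - (j + 1),
      hM := by omega, reg := fun _ => ∅ }, rfl, rfl⟩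

end Literature.MathematicalPhysics.QuantumFieldTheory.Balaban1983to89.B2Eq39ConcreteForms

end
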